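import Literature.AnabelianGeometry.AbsoluteAnabelian.AbsTopII.EllipticCuspidalization
import Literature.AnabelianGeometry.AbsoluteAnabelian.AbsTopISemiAbsoluteProofs
import Literature.AnabelianGeometry.AbsoluteAnabelian.MLFGaloisGroupsProofs
import HarnessLib

/-!
# [AbsTopII] Remark 3.3.2: a group-theoretic characterization of `Δ ⊆ Π` is preserved by
# isomorphisms of `Π` — kernel proofs

S. Mochizuki, *Topics in Absolute Anabelian Geometry II: Decomposition Groups and Endomorphisms*
[AbsTopII], Remark 3.3.2 p. 69 (manuscript pagination, lit key `paper:url-585b8d0ad0d9`; bib key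
`MochizukiAbsTopII2013`): "Recall that when `k` is an MLF or an NF, the subgroup `Δ ⊆ Π` admits a
purely 'group-theoretic' characterization [cf. [Mzk15], Theorem 2.6, (v), (vi)]. Thus, when `k` is
an MLF or an NF, the various 'group-theoretic' reconstruction algorithms described in the
statement of Corollary 3.3 may be thought of as being applied not to the extension
`1 → Δ → Π → G → 1`, but rather to the single profinite group `Π`."  The cell typed the invoked
content as `AbsTopII.Rmk_3_3_2 𝒦` (abc-iut-L4-t6, `AbsTopII/EllipticCuspidalization.lean`): every
isomorphism of the profinite groups `Π` of two members of the class `𝒦` carries `Δ` onto `Δ` (the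
same predicate, for one isomorphism, is abc-iut-L4-t4's `FundamentalExtension.PreservesGeom`,
[AbsAnab] Lemma 1.3.8).

PROVED here (proof-only file, no new definitions) — the deduction (group-theoretic
characterization ⟹ preserved by arbitrary isomorphisms of topological groups) for the two
characterizations of [AbsTopI] Thm 2.6 (v), (vi) as typed by abc-iut-L4-t4
(`AbsTopISemiAbsolute.lean`):

* (vi), `k` an NF: `Δ` = "the maximal topologically finitely generated closed normal subgroup of
  `Π`" (`FundamentalExtension.GeomIsMaxTFGNormalIn ⊤`).  Transport: the image of a topologically
  finitely generated closed normal subgroup under `φ : Π₁ ⥲ Π₂` is again such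
  (`geom_map_le_of_geomIsMaxTFGNormalIn`, `geom_map_eq_of_geomIsMaxTFGNormalIn`); hence
  `rmk_3_3_2_of_geomIsMaxTFGNormalIn : Rmk_3_3_2 {E | E.GeomIsMaxTFGNormalIn ⊤}` and, through
  abc-iut-L4-t4's kernel proof of [AbsAnab] Lemma 1.1.4 (i) from [AbsAnab] Thm 1.1.2
  (`thm26_vi_maximal_of_tfgNormalSubgroup_trivial`), the NF case
  `rmk_3_3_2_NF_of_tfgNormalSubgroup_trivial` for ALL extensions `1 → Δ → Π → G_F → 1` with
  `Δ` topologically finitely generated, CONDITIONAL only on the named fact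
  `galoisNF_tfgNormalSubgroup_trivial` ([AbsAnab] Thm 1.1.2 = [FJ] Thm 15.10).
* (v), `k` an MLF (case `Θ = {1}`): `Δ` = "the intersection of the open subgroups `H ⊆ Π` such
  that `ζ̃(H)/ζ̃(Π) = [Π : H]`" (`FundamentalExtension.Thm26v`, second conjunct).  Transport: `φ`
  induces a bijection on open subgroups preserving the index and the invariant `ζ` (built from the
  free pro-`l` ranks `δ¹_l`, invariant by abc-iut-L4-t4's `freeProlRank_eq_of_continuousMulEquiv`);
  hence `zetaInv_eq_of_continuousMulEquiv`, `geom_map_eq_of_zeta_characterization` and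
  `rmk_3_3_2_of_thm26v : Rmk_3_3_2 {E | ∃ B : E.MLFBase, E.Thm26v B}` (unconditional relative to the
  typed predicate `Thm26v`; [AbsTopI] Thm 2.6 (v) itself is abc-iut-L4-t4's node).

Also the one-isomorphism forms, as `FundamentalExtension.PreservesGeom` ([AbsAnab] Lemma 1.3.8
shape).

HONEST FRAMING: kernel checks of elementary deductions inside refereed, undisputed papers
([AbsTopI], [AbsTopII], [AbsAnab]); nothing here bears on [IUTchIII] Cor 3.12; typed ≠ discharged
for the deep inputs (`Thm26v`, `galoisNF_tfgNormalSubgroup_trivial`), which stay hypotheses.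
-/

noncomputable section

open Topology

namespace Literature.AnabelianGeometry.AbsoluteAnabelian

open Literature.AlgebraicGeometry.Frobenioids (IsSlimGroup)

universe u

/-! ### Transport of subgroups and invariants along `φ : Π₁ ⥲ Π₂` -/

section Transport

variable {A B : Type u} [Group A] [TopologicalSpace A] [Group B] [TopologicalSpace B]

/-- The underlying set of the image subgroup is the image set. [folklore] -/
private theorem coe_map_continuousMulEquiv (φ : A ≃ₜ* B) (N : Subgroup A) :
    ((N.map φ.toMulEquiv.toMonoidHom : Subgroup B) : Set B) = φ '' (N : Set A) := by
  ext y
  simp only [Subgroup.coe_map, Set.mem_image, SetLike.mem_coe]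
  constructor
  · rintro ⟨x, hx, rfl⟩
    exact ⟨x, hx, rfl⟩
  · rintro ⟨x, hx, rfl⟩
    exact ⟨x, hx, rfl⟩

/-- Membership in the image subgroup along `φ` is membership of `φ⁻¹ y`. [folklore] -/
private theorem mem_map_continuousMulEquiv_iff (φ : A ≃ₜ* B) (N : Subgroup A)
    (y : B) :
    y ∈ N.map φ.toMulEquiv.toMonoidHom ↔ φ.symm y ∈ N := by
  constructor
  · rintro ⟨x, hx, rfl⟩
    change φ.symm (φ x) ∈ N
    rwa [φ.symm_apply_apply]
  · intro h
    exact ⟨φ.symm y, h, φ.apply_symm_apply y⟩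

/-- The image along `φ` of a closed subgroup is closed (`φ` is a homeomorphism). [folklore] -/
private theorem isClosed_map_continuousMulEquiv (φ : A ≃ₜ* B) {N : Subgroup A}
    (hN : IsClosed (N : Set A)) :
    IsClosed ((N.map φ.toMulEquiv.toMonoidHom : Subgroup B) : Set B) := by
  rw [coe_map_continuousMulEquiv]
  exact φ.toHomeomorph.isClosedMap _ hN

/-- The preimage along `φ` of an open subgroup is open. [folklore] -/
private theorem isOpen_comap_continuousMulEquiv (φ : A ≃ₜ* B) {H : Subgroup B}
    (hH : IsOpen (H : Set B)) :
    IsOpen ((H.comap φ.toMulEquiv.toMonoidHom : Subgroup A) : Set A) :=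
  hH.preimage φ.continuous

/-- The image along `φ` of a normal subgroup is normal (`φ` is surjective). [folklore] -/
private theorem normal_map_continuousMulEquiv (φ : A ≃ₜ* B) {N : Subgroup A}
    (hN : N.Normal) :
    (N.map φ.toMulEquiv.toMonoidHom).Normal :=
  hN.map φ.toMulEquiv.toMonoidHom φ.surjective

/-- A subgroup is bicontinuously isomorphic to its image along `φ` (stated as an existence so
that this file declares no data). [folklore] -/
private theorem nonempty_continuousMulEquiv_map (φ : A ≃ₜ* B) (N : Subgroup A) :
    Nonempty (N ≃ₜ* (N.map φ.toMulEquiv.toMonoidHom : Subgroup B)) := by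
  refine ⟨{ toFun := fun x => ⟨φ x, ⟨x, x.2, rfl⟩⟩
            invFun := fun y => ⟨φ.symm y, (mem_map_continuousMulEquiv_iff φ N y).mp y.2⟩
            left_inv := fun x => Subtype.ext (φ.symm_apply_apply x)
            right_inv := fun y => Subtype.ext (φ.apply_symm_apply y)
            map_mul' := fun x y => Subtype.ext (map_mul φ (x : A) (y : A))
            continuous_toFun := ?_
            continuous_invFun := ?_ }⟩
  · exact (φ.continuous.comp continuous_subtype_val).subtype_mk _
  · exact (φ.symm.continuous.comp continuous_subtype_val).subtype_mk _

/-- A subgroup of `B` is bicontinuously isomorphic to its preimage along `φ` (existence form).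
[folklore] -/
private theorem nonempty_continuousMulEquiv_comap (φ : A ≃ₜ* B) (H : Subgroup B) :
    Nonempty ((H.comap φ.toMulEquiv.toMonoidHom : Subgroup A) ≃ₜ* H) := by
  refine ⟨{ toFun := fun x => ⟨φ x, x.2⟩
            invFun := fun y => ⟨φ.symm y, by
              change φ (φ.symm y) ∈ H
              rw [φ.apply_symm_apply]; exact y.2⟩
            left_inv := fun x => Subtype.ext (φ.symm_apply_apply x)
            right_inv := fun y => Subtype.ext (φ.apply_symm_apply y)
            map_mul' := fun x y => Subtype.ext (map_mul φ (x : A) (y : A))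
            continuous_toFun := ?_
            continuous_invFun := ?_ }⟩
  · exact (φ.continuous.comp continuous_subtype_val).subtype_mk _
  · exact (φ.symm.continuous.comp continuous_subtype_val).subtype_mk _

/-- Topological finite generation of a subgroup passes to its image along `φ`.
[cite: MochizukiAbsTopI2012, §0 p.8] -/
theorem isTopologicallyFinitelyGenerated_map_continuousMulEquiv [IsTopologicalGroup A]
    [IsTopologicalGroup B] (φ : A ≃ₜ* B) {N : Subgroup A}
    (hN : IsTopologicallyFinitelyGenerated N) :
    IsTopologicallyFinitelyGenerated (N.map φ.toMulEquiv.toMonoidHom : Subgroup B) := by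
  obtain ⟨e⟩ := nonempty_continuousMulEquiv_map φ N
  exact hN.of_continuousMulEquiv e

/-- Topological finite generation of a subgroup depends only on the subgroup (transport along an
equality of subgroups, avoiding dependent rewriting). [folklore] -/
private theorem IsTopologicallyFinitelyGenerated.of_subgroup_eq [IsTopologicalGroup A]
    {H K : Subgroup A} (h : H = K) (hH : IsTopologicallyFinitelyGenerated H) :
    IsTopologicallyFinitelyGenerated K := by
  subst h
  exact hH

/-- The index of the preimage of a subgroup along `φ` equals the index. [folklore] -/
private theorem index_comap_continuousMulEquiv (φ : A ≃ₜ* B) (H : Subgroup B) :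
    (H.comap φ.toMulEquiv.toMonoidHom).index = H.index :=
  Subgroup.index_comap_of_surjective H φ.surjective

/-- The invariant `ζ` of [AbsTopI] Thm 2.6 (the supremum of the differences of free pro-`l` ranks
`δ¹_p − δ¹_{p'}`) is an invariant of the isomorphism class of the topological group (each `δ¹_l`
is, abc-iut-L4-t4's `freeProlRank_eq_of_continuousMulEquiv`).
[cite: MochizukiAbsTopI2012, Thm 2.6 p.21] -/
theorem zetaInv_eq_of_continuousMulEquiv (e : A ≃ₜ* B) : zetaInv A = zetaInv B := by
  unfold zetaInv
  refine iSup_congr fun p => iSup_congr fun p' => ?_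
  rw [@freeProlRank_eq_of_continuousMulEquiv A _ _ B _ _ e p.1 ⟨p.2⟩,
    @freeProlRank_eq_of_continuousMulEquiv A _ _ B _ _ e p'.1 ⟨p'.2⟩]

end Transport

namespace FundamentalExtension

variable {E F : FundamentalExtension.{u}}

/-! ### [AbsTopI] Thm 2.6 (vi)-type characterization: the maximal tfg closed normal subgroup -/

/-- If `Δ_E` is topologically finitely generated and `Δ_F` is the maximal topologically finitely
generated closed normal subgroup of `Π_F` ([AbsTopI] Thm 2.6 (vi): "The kernel of the quotient
`Π ↠ G` may be characterized ['group-theoretically'] as the maximal topologically finitely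
generated closed normal subgroup of `Π`"), then every isomorphism of topological groups
`φ : Π_E ⥲ Π_F` maps `Δ_E` into `Δ_F`. [cite: MochizukiAbsTopI2012, Thm 2.6 (vi) p.22] -/
theorem geom_map_le_of_geomIsMaxTFGNormalIn (hE : IsTopologicallyFinitelyGenerated E.geom)
    (hF : F.GeomIsMaxTFGNormalIn ⊤) (φ : E.arith ≃ₜ* F.arith) :
    E.geom.map φ.toMulEquiv.toMonoidHom ≤ F.geom := by
  have hnormal : (E.geom.map φ.toMulEquiv.toMonoidHom).Normal :=
    normal_map_continuousMulEquiv φ E.normal_geom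
  have h := hF.2 (E.geom.map φ.toMulEquiv.toMonoidHom) le_top
    (by haveI := hnormal; infer_instance)
    (isClosed_map_continuousMulEquiv φ E.isClosed_geom)
    (isTopologicallyFinitelyGenerated_map_continuousMulEquiv φ hE)
  exact h.trans inf_le_left

/-- The first conjunct of `GeomIsMaxTFGNormalIn ⊤` is topological finite generation of `Δ`
itself (`Δ ∩ Π = Δ`). [cite: MochizukiAbsAnab2004, Lemma 1.1.4 (i) p.7] -/
theorem isTopologicallyFinitelyGenerated_geom_of_geomIsMaxTFGNormalIn
    (hE : E.GeomIsMaxTFGNormalIn ⊤) : IsTopologicallyFinitelyGenerated E.geom :=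
  IsTopologicallyFinitelyGenerated.of_subgroup_eq (inf_top_eq E.geom) hE.1

/-- **Transport of the Thm 2.6 (vi) characterization**: if in BOTH extensions `Δ` is the maximal
topologically finitely generated closed normal subgroup of `Π`, then every isomorphism of
topological groups `φ : Π_E ⥲ Π_F` carries `Δ_E` ONTO `Δ_F` — `Δ ⊆ Π` is group-theoretic in the
sense of [AbsTopII] Rmk 3.3.2. [cite: MochizukiAbsTopII2013, Rmk 3.3.2 p.69] -/
theorem geom_map_eq_of_geomIsMaxTFGNormalIn (hE : E.GeomIsMaxTFGNormalIn ⊤)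
    (hF : F.GeomIsMaxTFGNormalIn ⊤) (φ : E.arith ≃ₜ* F.arith) :
    E.geom.map φ.toMulEquiv.toMonoidHom = F.geom := by
  refine le_antisymm (geom_map_le_of_geomIsMaxTFGNormalIn
    (isTopologicallyFinitelyGenerated_geom_of_geomIsMaxTFGNormalIn hE) hF φ) ?_
  intro y hy
  have hle := geom_map_le_of_geomIsMaxTFGNormalIn
    (isTopologicallyFinitelyGenerated_geom_of_geomIsMaxTFGNormalIn hF) hE φ.symm
  have hy' : φ.symm y ∈ E.geom := hle ⟨y, hy, rfl⟩
  exact (mem_map_continuousMulEquiv_iff φ E.geom y).mpr hy'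

/-- The same, in abc-iut-L4-t4's [AbsAnab] Lemma 1.3.8 shape `PreservesGeom`.
[cite: MochizukiAbsAnab2004, Lemma 1.3.8 p.18] -/
theorem preservesGeom_of_geomIsMaxTFGNormalIn (hE : E.GeomIsMaxTFGNormalIn ⊤)
    (hF : F.GeomIsMaxTFGNormalIn ⊤) (α : E.arith ≃ₜ* F.arith) : PreservesGeom α :=
  geom_map_eq_of_geomIsMaxTFGNormalIn hE hF α

/-! ### [AbsTopI] Thm 2.6 (v)-type characterization: the `ζ`-intersection -/

/-- **Transport of the Thm 2.6 (v) characterization** (case `Θ = {1}`): if in BOTH extensions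
`Δ` is "the intersection of the open subgroups `H ⊆ Π` such that `ζ̃(H)/ζ̃(Π) = [Π : H]`" (second
conjunct of `Thm26v`), then every isomorphism of topological groups `φ : Π_E ⥲ Π_F` carries `Δ_E`
onto `Δ_F`: `φ` induces a bijection of open subgroups preserving `[Π : H]` and `ζ`.
[cite: MochizukiAbsTopI2012, Thm 2.6 (v) p.22] -/
theorem geom_map_eq_of_zeta_characterization
    (hE : E.geom = ⨅ (H : Subgroup E.arith) (_ : IsOpen (H : Set E.arith))
      (_ : zetaInv H = (H.index : ℕ∞) * zetaInv E.arith), H)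
    (hF : F.geom = ⨅ (H : Subgroup F.arith) (_ : IsOpen (H : Set F.arith))
      (_ : zetaInv H = (H.index : ℕ∞) * zetaInv F.arith), H)
    (φ : E.arith ≃ₜ* F.arith) : E.geom.map φ.toMulEquiv.toMonoidHom = F.geom := by
  -- one inclusion for an arbitrary isomorphism, then symmetry
  have key : ∀ {E F : FundamentalExtension.{u}},
      (E.geom = ⨅ (H : Subgroup E.arith) (_ : IsOpen (H : Set E.arith))
        (_ : zetaInv H = (H.index : ℕ∞) * zetaInv E.arith), H) →
      (F.geom = ⨅ (H : Subgroup F.arith) (_ : IsOpen (H : Set F.arith))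
        (_ : zetaInv H = (H.index : ℕ∞) * zetaInv F.arith), H) →
      ∀ (φ : E.arith ≃ₜ* F.arith) (x : E.arith), x ∈ E.geom → φ x ∈ F.geom := by
    intro E F hE hF φ x hx
    rw [hF]
    simp only [Subgroup.mem_iInf]
    intro H hHopen hHζ
    -- pull `H` back to `Π_E`
    set H' : Subgroup E.arith := H.comap φ.toMulEquiv.toMonoidHom with hH'
    have hH'open : IsOpen (H' : Set E.arith) := isOpen_comap_continuousMulEquiv φ hHopen
    obtain ⟨e⟩ := nonempty_continuousMulEquiv_comap φ H
    have hH'ζ : zetaInv H' = (H'.index : ℕ∞) * zetaInv E.arith := by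
      rw [hH', index_comap_continuousMulEquiv φ H, zetaInv_eq_of_continuousMulEquiv e,
        zetaInv_eq_of_continuousMulEquiv φ]
      exact hHζ
    have hxH' : x ∈ H' := by
      rw [hE] at hx
      simp only [Subgroup.mem_iInf] at hx
      exact hx H' hH'open hH'ζ
    exact hxH'
  refine le_antisymm ?_ ?_
  · rintro y ⟨x, hx, rfl⟩
    exact key hE hF φ x hx
  · intro y hy
    exact (mem_map_continuousMulEquiv_iff φ E.geom y).mpr (key hF hE φ.symm y hy)

/-- The same for two extensions with MLF base data satisfying the typed [AbsTopI] Thm 2.6 (v)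
(`Thm26v`), in the `PreservesGeom` shape of [AbsAnab] Lemma 1.3.8. [cite: MochizukiAbsAnab2004,
Lemma 1.3.8 p.18] -/
theorem preservesGeom_of_thm26v {BE : E.MLFBase} {BF : F.MLFBase} (hE : E.Thm26v BE)
    (hF : F.Thm26v BF) (α : E.arith ≃ₜ* F.arith) : PreservesGeom α :=
  geom_map_eq_of_zeta_characterization hE.2 hF.2 α

end FundamentalExtension

/-! ### [AbsTopII] Remark 3.3.2 for the corresponding classes -/

namespace AbsTopII

open FundamentalExtension

/-- **Remark 3.3.2, NF-type characterization** (PROVED): on the class of extensions in which `Δ`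
is the maximal topologically finitely generated closed normal subgroup of `Π` ([AbsTopI] Thm 2.6
(vi)), every isomorphism of the profinite groups `Π` of two members carries `Δ` onto `Δ`.
[cite: MochizukiAbsTopII2013, Rmk 3.3.2 p.69] -/
theorem rmk_3_3_2_of_geomIsMaxTFGNormalIn :
    Rmk_3_3_2 {E : FundamentalExtension.{u} | E.GeomIsMaxTFGNormalIn ⊤} :=
  fun _ hE _ hF φ => geom_map_eq_of_geomIsMaxTFGNormalIn hE hF φ

/-- **Remark 3.3.2, `k` an NF** (PROVED modulo [AbsAnab] Thm 1.1.2): GIVEN the named fact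
`galoisNF_tfgNormalSubgroup_trivial` ([AbsAnab] Thm 1.1.2 p. 6 = [FJ] Thm 15.10: every topologically
finitely generated closed normal subgroup of `G_F` is trivial), Remark 3.3.2 holds on the class of
ALL extensions `1 → Δ → Π → G → 1` with `G ≅ G_F`, `F` a number field, and `Δ` topologically
finitely generated ([AbsTopI] Prop 2.2 supplies the latter for extensions of GSAFG-type): the route
Thm 1.1.2 ⟹ Lemma 1.1.4 (i) ⟹ Thm 2.6 (vi) is abc-iut-L4-t4's kernel theorem
`thm26_vi_maximal_of_tfgNormalSubgroup_trivial`. [cite: MochizukiAbsTopII2013, Rmk 3.3.2 p.69] -/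
theorem rmk_3_3_2_NF_of_tfgNormalSubgroup_trivial (h112 : galoisNF_tfgNormalSubgroup_trivial) :
    Rmk_3_3_2 {E : FundamentalExtension.{0} |
      Nonempty E.NFBase ∧ IsTopologicallyFinitelyGenerated E.geom} := by
  intro E hE F hF φ
  obtain ⟨⟨BE⟩, hΔE⟩ := hE
  obtain ⟨⟨BF⟩, hΔF⟩ := hF
  exact geom_map_eq_of_geomIsMaxTFGNormalIn
    (thm26_vi_maximal_of_tfgNormalSubgroup_trivial h112 E BE hΔE)
    (thm26_vi_maximal_of_tfgNormalSubgroup_trivial h112 F BF hΔF) φ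

/-- **Remark 3.3.2 via the typed [AbsTopI] Thm 2.6 (vi)** (PROVED): on the class of extensions
satisfying abc-iut-L4-t4's `Thm26vi` (whose second conjunct is the maximal-tfg characterization),
every isomorphism of the `Π`'s carries `Δ` onto `Δ`.
[cite: MochizukiAbsTopII2013, Rmk 3.3.2 p.69] -/
theorem rmk_3_3_2_of_thm26vi : Rmk_3_3_2 {E : FundamentalExtension.{u} | E.Thm26vi} :=
  fun _ hE _ hF φ => geom_map_eq_of_geomIsMaxTFGNormalIn hE.2.1 hF.2.1 φ

/-- **Remark 3.3.2, `k` an MLF** (PROVED relative to the typed [AbsTopI] Thm 2.6 (v)): on the class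
of extensions with MLF base data `G ≅ G_K` satisfying `Thm26v` ([AbsTopI] Thm 2.6 (v): "the kernel
of the quotient `Π ↠ G` may be characterized [...] as the intersection of the open subgroups
`H ⊆ Π` such that `ζ̃(H)/ζ̃(Π) = [Π : H]`", case `Θ = {1}` — the case `Σ` = all primes of
[IUTchI–III]), every isomorphism of the profinite groups `Π` of two members carries `Δ` onto `Δ`.
[cite: MochizukiAbsTopII2013, Rmk 3.3.2 p.69] -/
theorem rmk_3_3_2_of_thm26v :
    Rmk_3_3_2 {E : FundamentalExtension.{u} | ∃ B : E.MLFBase, E.Thm26v B} := by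
  intro E hE F hF φ
  obtain ⟨BE, hBE⟩ := hE
  obtain ⟨BF, hBF⟩ := hF
  exact geom_map_eq_of_zeta_characterization hBE.2 hBF.2 φ

/-- Remark 3.3.2 on the union of the NF-type class and the MLF-type class would be FALSE to ask
across types only if an NF-`Π` could be isomorphic to an MLF-`Π`; print keeps the two cases apart
("when `k` is an MLF or an NF"), and so do the statements above.  For the record, the MIXED
sub-case never arises inside one isomorphism class when `Δ` is topologically finitely generated:
an NF-based `Π` is not topologically finitely generated ([AbsTopI] Thm 2.6 (vi), abc-iut-L4-t4's
`thm26_vi_not_tfg`) — no claim typed here beyond this remark.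
[cite: MochizukiAbsTopII2013, Rmk 3.3.2 p.69] -/
theorem rmk_3_3_2_mono_NF (h112 : galoisNF_tfgNormalSubgroup_trivial)
    {𝒦 : Set FundamentalExtension.{0}}
    (h𝒦 : 𝒦 ⊆ {E | Nonempty E.NFBase ∧ IsTopologicallyFinitelyGenerated E.geom}) : Rmk_3_3_2 𝒦 :=
  (rmk_3_3_2_NF_of_tfgNormalSubgroup_trivial h112).mono h𝒦

end AbsTopII

end Literature.AnabelianGeometry.AbsoluteAnabelian
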